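import Summits.CriticalPhenomena.PercolationContinuityZ3.Theorems.Transplant.Slab111HubU19Rules
import HarnessLib

/-!
# The HUB ROUTING of the `(111)`-films, XX: the swap pair at an UNCLIPPED-SHAPE block from the dispatcher tables (`linkage_U19`)

builds on p205010 (kernel theorem, internal audit signed; external expert review pending) — NOT used in this file.  Lane `prim-bschramm`, seat
`prim-bschramm-p2` (gen 36; class C1b; memo `HOME/bschramm/P2-LATTICES.md` §130); helper file (`--supports stmt-CriticalPhenomena-4575 --as helper`).
**`linkage_U19`**: for `k ≥ 51` and a block `(z, t_R, t_D, s_R, s_D)` of «HexShadowVRouteData».`ShapedLinkage 3` with `t_R, s_R ≥ 2`, GIVEN the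
dispatcher tables of the unclipped shape (hypothesis `htab`: for all terminal columns `q₁, q₂` a table `(A, C)` passing «Slab111HubTab3».`tab3OK`;
discharged by `decide +kernel` in the table files), the cleared set «Slab111HubW18».`W18 k z` carries a swap pair for every certified terminal
triple.  Assembly: terminal data (§1) → zone («Slab111HubZone») → sides, flags, clamped differences and their rules («Slab111HubTypes3»,
«Slab111HubU19Rules») → the entry of the table (`tab3OK_sound`) → the hypotheses of «Slab111HubEntry2».`Entry.swap2` (§2) → the swap pair.
[cite: DuminilCopinSidoraviciusTassion2016, §2.3 (proof of Fact 2: the three disjoint paths γ_u, γ_v, γ_w in B_R(z))]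
-/

noncomputable section

namespace Summit.CriticalPhenomena.PercolationContinuityZ3.Theorems.Transplant

open Literature.Probability.Percolation Literature.Probability.LatticeModels SimpleGraph
open scoped Classical

namespace Slab111

variable {k : ℕ}

/-! ## §1 Small facts -/

/-- Membership in the hexagon as a Boolean predicate (the region predicate handed to `Entry.baseB`). [folklore] -/
def inHex2B (q : ℤ × ℤ) : Bool := decide (tnZ q ≤ 2)

/-- Soundness of `inHex2B`. [folklore] -/
theorem mem_hex2_of_inHex2B : ∀ q, inHex2B q = true → q ∈ hex2 := fun q h =>
  mem_hex2_of_tnZ (by unfold inHex2B at h; exact of_decide_eq_true h)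

/-- A nonzero column of the hexagon is in `hex2.tail`. [folklore] -/
theorem mem_hex2_tail {q : ℤ × ℤ} (h : q ∈ hex2) (h0 : q ≠ (0, 0)) : q ∈ hex2.tail := by
  unfold hex2 at h ⊢
  rw [List.mem_cons] at h
  rcases h with h | h
  · exact absurd h h0
  · exact h

/-- `vcol z (0,0) = z`. [folklore] -/
theorem vcol_zero (z : Site 2) : vcol z ((0 : ℤ), (0 : ℤ)) = z := by
  ext i; fin_cases i <;> simp [vcol]

/-- **The five pair hypotheses of `Entry.swap2`, uniformly** (same side: «Slab111HubTypes3».`pair_hyps`; opposite sides: the zone separates). [folklore] -/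
theorem pair_pack {Hlo nI nJ : ℤ} (hcI : Clears 3 Hlo nI) (hcJ : Clears 3 Hlo nJ) {lI lJ : List MV} {qI qJ : ℤ × ℤ} {FI FJ : FaceD}
    (hv : dirOfLevel 3 Hlo nI = dirOfLevel 3 Hlo nJ → pairOKB lI lJ qI qJ FI FJ (dirOfLevel 3 Hlo nI) (clampτ (nJ - nI)) = true) :
    (xbOf Hlo nI nJ = true → LegAvoids lI qI FJ) ∧ (xbOf Hlo nJ nI = true → LegAvoids lJ qJ FI) ∧
    (xbOf Hlo nI nJ = true ∨ nI + 3 < min (nJ - 3) (Hlo - 1) ∨ max (nJ + 3) (Hlo + 3 + 1) < nI - 3 ∨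
      LocSep lI lJ qI FJ (dirOfLevel 3 Hlo nI) nI nJ) ∧
    (xbOf Hlo nJ nI = true ∨ nJ + 3 < min (nI - 3) (Hlo - 1) ∨ max (nI + 3) (Hlo + 3 + 1) < nJ - 3 ∨
      LocSep lJ lI qJ FI (dirOfLevel 3 Hlo nJ) nJ nI) ∧
    ((nI + 2 * 3 < nJ ∨ nJ + 2 * 3 < nI) ∨
      ∀ p ∈ lI, ∀ p' ∈ lJ, -(3 : ℤ) ≤ p.2 → p.2 ≤ 3 → -(3 : ℤ) ≤ p'.2 → p'.2 ≤ 3 → (qI + p.1, nI + p.2) ≠ (qJ + p'.1, nJ + p'.2)) := by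
  by_cases hd : dirOfLevel 3 Hlo nI = dirOfLevel 3 Hlo nJ
  · obtain ⟨a1, a2, s1, s2, f⟩ := pair_hyps hcI hcJ hd (hv hd)
    exact ⟨a1, a2, s1, s2, f.imp_right fun h p hp p' hp' _ _ _ _ => h p hp p' hp'⟩
  · obtain ⟨x1, s1, f1⟩ := pair_hyps_opp hcI hcJ hd
    obtain ⟨x2, s2, -⟩ := pair_hyps_opp hcJ hcI (Ne.symm hd)
    refine ⟨fun h => ?_, fun h => ?_, ?_, ?_, Or.inl f1⟩
    · rw [x1] at h; exact absurd h (by simp)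
    · rw [x2] at h; exact absurd h (by simp)
    · rcases s1 with h | h
      · exact Or.inr (Or.inl h)
      · exact Or.inr (Or.inr (Or.inl h))
    · rcases s2 with h | h
      · exact Or.inr (Or.inl h)
      · exact Or.inr (Or.inr (Or.inl h))

/-! ## §2 The block theorem -/

set_option maxHeartbeats 4000000 in
/-- **THE SWAP PAIR AT AN UNCLIPPED-SHAPE BLOCK** (`t_R, s_R ≥ 2`, `k ≥ 51`), given the dispatcher tables of the unclipped shape. [folklore] -/
theorem linkage_U19 (hk : 51 ≤ k)
    (htab : ∀ q₁ ∈ hex2.tail, ∀ q₂ ∈ hex2.tail, ∃ A C : ℕ, tab3OK inHex2B inHex2B u19Bad u19Filt hex2 q₁ q₂ A C = true)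
    (z : Site 2) {tR tD sR sD : ℕ} (htR : 2 ≤ tR) (hsR : 2 ≤ sR) (htD : tR ≤ tD) (hsD : sR ≤ sD) :
    ∃ W : Set (slab111 k), (∀ x ∈ W, (hexShadow k).sh x ∈ blkR 3 z tD sD) ∧
      (∀ x, (hexShadow k).sh x ∈ hexBall z 1 → (hexShadow k).sh x ∈ blkR 3 z tD sD → x ∈ W) ∧
      ∀ (E₁ E₂ w' : slab111 k), (hexShadow k).Terminals 3 z tR tD sR W E₁ E₂ w' →
        ∃ r₁ r₂ : VRouteData (film k) (W ∩ (hexShadow k).lift (blkR 3 z tR sR)) W E₁ E₂ w', r₁.y = r₂.b ∧ r₁.b = r₂.y := by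
  refine ⟨W18 k z, fun x hx => W18_subset_blkR z (le_trans htR htD) (le_trans hsR hsD) x hx,
    fun x h1 _ => mem_W18_of_hexBall_one z x h1, ?_⟩
  intro E₁ E₂ w' hT
  have hkZ : (51 : ℤ) ≤ k := by exact_mod_cast hk
  have hPRW : W18 k z ∩ (hexShadow k).lift (blkR 3 z tR sR) ⊆ W18 k z := Set.inter_subset_left
  have hWPR : W18 k z ⊆ W18 k z ∩ (hexShadow k).lift (blkR 3 z tR sR) := fun x hx => ⟨hx, W18_subset_lift z htR hsR hx⟩
  have hz : (3 : ℤ) ∣ z 0 + 2 * z 1 - (z 0 + 2 * z 1) := dvd_cls_self z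
  -- terminal data
  obtain ⟨hq1, hs1, h01, hk1⟩ := member_facts' hT.E₁W
  obtain ⟨hq2, hs2, h02, hk2⟩ := member_facts' hT.E₂W
  obtain ⟨hq3, hs3, h03, hk3⟩ := member_facts' hT.w'W
  have hE1 : sh E₁ = vcol z (relC z E₁) ∧ lev (E₁ : Site 3) = lev (E₁ : Site 3) := ⟨hs1, rfl⟩
  have hE2 : sh E₂ = vcol z (relC z E₂) ∧ lev (E₂ : Site 3) = lev (E₂ : Site 3) := ⟨hs2, rfl⟩
  have hE3 : sh w' = vcol z (relC z w') ∧ lev (w' : Site 3) = lev (w' : Site 3) := ⟨hs3, rfl⟩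
  have hE1P : E₁ ∈ W18 k z ∩ (hexShadow k).lift (blkR 3 z tR sR) := hWPR hT.E₁W
  have hE2P : E₂ ∈ W18 k z ∩ (hexShadow k).lift (blkR 3 z tR sR) := hWPR hT.E₂W
  have hq10 : relC z E₁ ≠ (0, 0) := fun e => hT.E₁z (show sh E₁ = z by rw [hs1, e, vcol_zero])
  have hq20 : relC z E₂ ≠ (0, 0) := fun e => hT.E₂z (show sh E₂ = z by rw [hs2, e, vcol_zero])
  have hq30 : relC z w' ≠ (0, 0) := fun e => hT.w'z (show sh w' = z by rw [hs3, e, vcol_zero])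
  have hw1 : sh w' ≠ sh E₁ := hT.w'E₁
  have hw2 : sh w' ≠ sh E₂ := hT.w'E₂
  have hq31 : relC z w' ≠ relC z E₁ := relC_ne_of_sh_ne hw1
  have hq32 : relC z w' ≠ relC z E₂ := relC_ne_of_sh_ne hw2
  have hne12 : (relC z E₁, lev (E₁ : Site 3)) ≠ (relC z E₂, lev (E₂ : Site 3)) := by
    intro e; simp only [Prod.mk.injEq] at e
    exact hT.ne (eq_of_sh_eq_of_lev_eq (by rw [hs1, hs2, e.1]) e.2)
  have hne13 : (relC z E₁, lev (E₁ : Site 3)) ≠ (relC z w', lev (w' : Site 3)) := by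
    intro e; simp only [Prod.mk.injEq] at e; exact hq31 e.1.symm
  have hne23 : (relC z E₂, lev (E₂ : Site 3)) ≠ (relC z w', lev (w' : Site 3)) := by
    intro e; simp only [Prod.mk.injEq] at e; exact hq32 e.1.symm
  have hcl1 := cls_of_sh_lev hz hE1
  have hcl2 := cls_of_sh_lev hz hE2
  have hcl3 := cls_of_sh_lev hz hE3
  -- the zone
  obtain ⟨Hlo, hH, hH2, hHk, hc1, hc2, hc3⟩ :=
    zone_exists (z 0 + 2 * z 1) (Λ := 3) (k := k) (by norm_num) (by omega) ⟨h01, hk1⟩ ⟨h02, hk2⟩ ⟨h03, hk3⟩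
  have hd1 := dirOfLevel_eq 3 Hlo (lev (E₁ : Site 3))
  have hd2 := dirOfLevel_eq 3 Hlo (lev (E₂ : Site 3))
  have hd3 := dirOfLevel_eq 3 Hlo (lev (w' : Site 3))
  -- the terminal rules
  obtain ⟨o₁, a₁, a₂, o₂, hoE1, hEa1, haE2, hEo2, ho1, ho2, -, -, -, -, ha1o1, ha1E2, ha2o2, ha2E1, -, -, -, -, -, hwa1, hwa2, -⟩ := hT.nbrs
  have hwa1' : sh a₁ ≠ sh w' := fun e => hwa1 e.symm
  have hwa2' : sh a₂ ≠ sh w' := fun e => hwa2 e.symm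
  have hX1 := ruleX_of_terminal hH2 hHk hT.E₁W hc1 ho1 hoE1.symm
  have hX2 := ruleX_of_terminal hH2 hHk hT.E₂W hc2 ho2 hEo2
  have hR1 : ruleR2B (relC z E₁) (relC z E₂) (relC z w') (dirOfLevel 3 Hlo (lev (E₁ : Site 3))) (dirOfLevel 3 Hlo (lev (E₂ : Site 3)))
      (βOf k (dirOfLevel 3 Hlo (lev (E₁ : Site 3))) (lev (E₁ : Site 3))) (βOf k (dirOfLevel 3 Hlo (lev (E₂ : Site 3))) (lev (E₂ : Site 3))) =
      true := by
    by_cases hβ : βOf k (dirOfLevel 3 Hlo (lev (E₁ : Site 3))) (lev (E₁ : Site 3)) = 0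
    · exact ruleR2_of_terminal (by omega) hβ ho1 hoE1 hEa1 ha1o1 ha1E2 hwa1' hd2 ⟨h02, hk2⟩
    · unfold ruleR2B; simp [hβ]
  have hR2 : ruleR2B (relC z E₂) (relC z E₁) (relC z w') (dirOfLevel 3 Hlo (lev (E₂ : Site 3))) (dirOfLevel 3 Hlo (lev (E₁ : Site 3)))
      (βOf k (dirOfLevel 3 Hlo (lev (E₂ : Site 3))) (lev (E₂ : Site 3))) (βOf k (dirOfLevel 3 Hlo (lev (E₁ : Site 3))) (lev (E₁ : Site 3))) =
      true := by
    by_cases hβ : βOf k (dirOfLevel 3 Hlo (lev (E₂ : Site 3))) (lev (E₂ : Site 3)) = 0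
    · exact ruleR2_of_terminal (by omega) hβ ho2 hEo2.symm haE2.symm ha2o2 ha2E1 hwa2' hd1 ⟨h01, hk1⟩
    · unfold ruleR2B; simp [hβ]
  have hrules : rulesB (relC z E₁) (relC z E₂) (relC z w') (dirOfLevel 3 Hlo (lev (E₁ : Site 3))) (dirOfLevel 3 Hlo (lev (E₂ : Site 3)))
      (dirOfLevel 3 Hlo (lev (w' : Site 3))) (βOf k (dirOfLevel 3 Hlo (lev (E₁ : Site 3))) (lev (E₁ : Site 3)))
      (βOf k (dirOfLevel 3 Hlo (lev (E₂ : Site 3))) (lev (E₂ : Site 3))) (βOf k (dirOfLevel 3 Hlo (lev (w' : Site 3))) (lev (w' : Site 3))) =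
      true := by
    unfold rulesB; rw [hX1, hX2, hR1, hR2]; rfl
  -- the entry of the table
  obtain ⟨A, C, htabq⟩ := htab _ (mem_hex2_tail hq1 hq10) _ (mem_hex2_tail hq2 hq20)
  have hfilt : u19Filt (relC z E₁) (relC z E₂) (relC z w') (dirOfLevel 3 Hlo (lev (E₁ : Site 3))) (dirOfLevel 3 Hlo (lev (E₂ : Site 3)))
      (dirOfLevel 3 Hlo (lev (w' : Site 3))) (βOf k (dirOfLevel 3 Hlo (lev (E₁ : Site 3))) (lev (E₁ : Site 3)))
      (βOf k (dirOfLevel 3 Hlo (lev (E₂ : Site 3))) (lev (E₂ : Site 3))) (βOf k (dirOfLevel 3 Hlo (lev (w' : Site 3))) (lev (w' : Site 3))) =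
      true := by
    have c1 := corner_of_flag (Hlo := Hlo) hT.E₁W; have c2 := corner_of_flag (Hlo := Hlo) hT.E₂W; have c3 := corner_of_flag (Hlo := Hlo) hT.w'W
    unfold u19Filt
    rw [hrules, Bool.and_true, Bool.and_eq_true, Bool.and_eq_true, Bool.not_eq_true', Bool.not_eq_true', Bool.not_eq_true',
      Bool.and_eq_false_iff, Bool.and_eq_false_iff, Bool.and_eq_false_iff]
    refine ⟨⟨?_, ?_⟩, ?_⟩
    · by_cases h : βOf k (dirOfLevel 3 Hlo (lev (E₁ : Site 3))) (lev (E₁ : Site 3)) = 0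
      · exact Or.inr (c1 h)
      · left; rw [beq_eq_false_iff_ne]; exact h
    · by_cases h : βOf k (dirOfLevel 3 Hlo (lev (E₂ : Site 3))) (lev (E₂ : Site 3)) = 0
      · exact Or.inr (c2 h)
      · left; rw [beq_eq_false_iff_ne]; exact h
    · by_cases h : βOf k (dirOfLevel 3 Hlo (lev (w' : Site 3))) (lev (w' : Site 3)) = 0
      · exact Or.inr (c3 h)
      · left; rw [beq_eq_false_iff_ne]; exact h
  obtain ⟨e, hbase, hacc1, hacc2, hacc3, hp12, hp13, hp23⟩ := tab3OK_sound htabq hq3 hq30 hq31 hq32 hd1 hd2 hd3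
    (βOf_lt _ _ _) (βOf_lt _ _ _) (βOf_lt _ _ _) hfilt
    (clampτ_mem_TAUS _) (clampτ_mem_TAUS _) (clampτ_mem_TAUS _)
    (fun hd => by rw [← hd]; exact pairRuleB_of_levels hd1 ⟨h01, hk1⟩ ⟨h02, hk2⟩ hne12)
    (fun hd => by rw [← hd]; exact pairRuleB_of_levels hd1 ⟨h01, hk1⟩ ⟨h03, hk3⟩ hne13)
    (fun hd => by rw [← hd]; exact pairRuleB_of_levels hd2 ⟨h02, hk2⟩ ⟨h03, hk3⟩ hne23)
    (fun _ _ => maybeB_of_levels _ _ _)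
  have hok0 := Entry.ok2_of_baseB mem_hex2_of_inHex2B mem_hex2_of_inHex2B hbase
  have hok0' := hok0
  obtain ⟨-, -, -, -, -, -, -, -, -, -, -, -, -, -, -, -, hL1, hL2, hL3, -⟩ := hok0'
  -- the pairs
  obtain ⟨a21, a12, t21, t12, f12⟩ := pair_pack hc1 hc2 hp12
  obtain ⟨a31, a13, t31, t13, f13⟩ := pair_pack hc1 hc3 hp13
  obtain ⟨a32, a23, t32, t23, f23⟩ := pair_pack hc2 hc3 hp23
  have hok := Entry.ok2_of_base hok0 a21 a31 a12 a32 a13 a23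
  -- the hub levels
  set d₁ := dirOfLevel 3 Hlo (lev (E₁ : Site 3)) with hd₁def
  set LA := laOf Hlo d₁ with hLAdef
  set LD := ldOf Hlo d₁ with hLDdef
  obtain ⟨hLA, hLD, hmin, hmax⟩ := laOf_spec hH hd1
  have hLA2 : 2 ≤ LA := by rw [hLAdef]; unfold laOf; split_ifs <;> omega
  have hLAk : LA ≤ (k : ℤ) - 2 := by rw [hLAdef]; unfold laOf; split_ifs <;> omega
  have hLD2 : 2 ≤ LD := by rw [hLDdef]; unfold ldOf; split_ifs <;> omega
  have hLDk : LD ≤ (k : ℤ) - 2 := by rw [hLDdef]; unfold ldOf; split_ifs <;> omega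
  have hz1 : (d₁ = 1 → lev (E₁ : Site 3) + 3 + 2 ≤ min LA LD) ∧ (d₁ = -1 → max LA LD + 3 + 2 ≤ lev (E₁ : Site 3)) := by
    rw [hmin, hmax]; exact dir_margin hc1
  have hz2 : (dirOfLevel 3 Hlo (lev (E₂ : Site 3)) = 1 → lev (E₂ : Site 3) + 3 + 2 ≤ min LA LD) ∧
      (dirOfLevel 3 Hlo (lev (E₂ : Site 3)) = -1 → max LA LD + 3 + 2 ≤ lev (E₂ : Site 3)) := by
    rw [hmin, hmax]; exact dir_margin hc2
  have hz3 : (dirOfLevel 3 Hlo (lev (w' : Site 3)) = 1 → lev (w' : Site 3) + 3 + 2 ≤ min LA LD) ∧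
      (dirOfLevel 3 Hlo (lev (w' : Site 3)) = -1 → max LA LD + 3 + 2 ≤ lev (w' : Site 3)) := by
    rw [hmin, hmax]; exact dir_margin hc3
  -- separations with the hub levels in place of the zone ends
  have s21 : xbOf Hlo (lev (E₁ : Site 3)) (lev (E₂ : Site 3)) = true ∨ lev (E₁ : Site 3) + 3 < min (lev (E₂ : Site 3) - 3) (min LA LD - 1) ∨
      max (lev (E₂ : Site 3) + 3) (max LA LD + 1) < lev (E₁ : Site 3) - 3 ∨ LocSep e.l₁ e.l₂ (relC z E₁) e.F2 d₁ (lev (E₁ : Site 3)) (lev (E₂ : Site 3)) := by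
    rw [hmin, hmax]; exact t21
  have s12 : xbOf Hlo (lev (E₂ : Site 3)) (lev (E₁ : Site 3)) = true ∨ lev (E₂ : Site 3) + 3 < min (lev (E₁ : Site 3) - 3) (min LA LD - 1) ∨
      max (lev (E₁ : Site 3) + 3) (max LA LD + 1) < lev (E₂ : Site 3) - 3 ∨
      LocSep e.l₂ e.l₁ (relC z E₂) e.F1 (dirOfLevel 3 Hlo (lev (E₂ : Site 3))) (lev (E₂ : Site 3)) (lev (E₁ : Site 3)) := by
    rw [hmin, hmax]; exact t12
  have s31 : xbOf Hlo (lev (E₁ : Site 3)) (lev (w' : Site 3)) = true ∨ lev (E₁ : Site 3) + 3 < min (lev (w' : Site 3) - 3) (min LA LD - 1) ∨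
      max (lev (w' : Site 3) + 3) (max LA LD + 1) < lev (E₁ : Site 3) - 3 ∨ LocSep e.l₁ e.l₃ (relC z E₁) e.F3 d₁ (lev (E₁ : Site 3)) (lev (w' : Site 3)) := by
    rw [hmin, hmax]; exact t31
  have s13 : xbOf Hlo (lev (w' : Site 3)) (lev (E₁ : Site 3)) = true ∨ lev (w' : Site 3) + 3 < min (lev (E₁ : Site 3) - 3) (min LA LD - 1) ∨
      max (lev (E₁ : Site 3) + 3) (max LA LD + 1) < lev (w' : Site 3) - 3 ∨
      LocSep e.l₃ e.l₁ (relC z w') e.F1 (dirOfLevel 3 Hlo (lev (w' : Site 3))) (lev (w' : Site 3)) (lev (E₁ : Site 3)) := by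
    rw [hmin, hmax]; exact t13
  have s32 : xbOf Hlo (lev (E₂ : Site 3)) (lev (w' : Site 3)) = true ∨ lev (E₂ : Site 3) + 3 < min (lev (w' : Site 3) - 3) (min LA LD - 1) ∨
      max (lev (w' : Site 3) + 3) (max LA LD + 1) < lev (E₂ : Site 3) - 3 ∨
      LocSep e.l₂ e.l₃ (relC z E₂) e.F3 (dirOfLevel 3 Hlo (lev (E₂ : Site 3))) (lev (E₂ : Site 3)) (lev (w' : Site 3)) := by
    rw [hmin, hmax]; exact t32
  have s23 : xbOf Hlo (lev (w' : Site 3)) (lev (E₂ : Site 3)) = true ∨ lev (w' : Site 3) + 3 < min (lev (E₂ : Site 3) - 3) (min LA LD - 1) ∨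
      max (lev (E₂ : Site 3) + 3) (max LA LD + 1) < lev (w' : Site 3) - 3 ∨
      LocSep e.l₃ e.l₂ (relC z w') e.F2 (dirOfLevel 3 Hlo (lev (w' : Site 3))) (lev (w' : Site 3)) (lev (E₂ : Site 3)) := by
    rw [hmin, hmax]; exact t23
  -- membership of the low leg vertices
  have hm1 := low_mem (z := z) hz hH2 hHk ⟨h01, hk1⟩ hcl1 hc1 hL1 hacc1
  have hm2 := low_mem (z := z) hz hH2 hHk ⟨h02, hk2⟩ hcl2 hc2 hL2 hacc2
  have hm3 := low_mem (z := z) hz hH2 hHk ⟨h03, hk3⟩ hcl3 hc3 hL3 hacc3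
  exact Entry.swap2 e hz hPRW
    (fun q hq L h1 hk' hd => hWPR (vl_mem_W18 hz q hq L h1 hk' hd)) (fun q hq L h1 hk' hd => vl_mem_W18 hz q hq L h1 hk' hd)
    hE1 hE2 hE3 hE1P hE2P hT.w'W hT.ne ⟨h01, hk1⟩ ⟨h02, hk2⟩ ⟨h03, hk3⟩ hd1 hd2 hd3 (by norm_num) hok
    (fun p hp hp0 hlow => let ⟨hr, hm⟩ := hm1 p hp hp0 hlow; ⟨hr, hWPR hm⟩)
    (fun p hp hp0 hlow => let ⟨hr, hm⟩ := hm2 p hp hp0 hlow; ⟨hr, hWPR hm⟩)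
    (fun p hp hp0 hlow => hm3 p hp hp0 hlow)
    hLA hLD hLA2 hLAk hLD2 hLDk hz1 hz2 hz3 f12 f13 f23 s21 s31 s12 s32 s13 s23

end Slab111

end Summit.CriticalPhenomena.PercolationContinuityZ3.Theorems.Transplant

end
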